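import Summits.QuantumFields.YangMills.Theorems.PoincareLipschitzHierAlignT3Simult
import Literature.MathematicalPhysics.QuantumFieldTheory.Balaban1983to89.BlockAveragingEMLLinearisedBackground
import HarnessLib

/-!
# Crux stmt-QuantumFields-19936 `HistoryTailL` — THE HIERARCHICAL ALIGNMENT IN THE CURRENCY OF THE RE-GAUGED TOWER («ALIGN-PERTVAR»):
# the sup-chart read as `‖pertVar‖`, and its transfer to ANY other tower of gauges at the price of the gauge drift at the two endpoints

Cell `ym3-torus` (YM ladder rung R3 = continuum SU(2) Yang–Mills on the three-torus — a RUNG, NOT the Clay problem; not d = 4, not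
infinite volume, not a mass gap), width seat `ym-ust-19936-w3` gen 12, `--supports stmt-QuantumFields-19936 --as helper`.  LEAD ★w1-19936 g7
words 01:07:50Z «ALIGN GO», 02:02:59Z (5) «SIMULT GO — the a-priori sup chart the annulus needs beyond j ≈ K∕2»; F6 pen = w2 g11 (the re-gauged
induction ✓`PoincareLipschitzRegaugedTowerInduction` ∕ ⧗`…RegaugedTowerStepMass`, whose letters are `pertVar V W b = W_b·V_b⁻¹ − 1` and whose
gauges `h_i` are built recursively, `h_{i+1} = g_i·(h_i ∘ emb)`).  ✓`PoincareLipschitzHierAlignT3Simult` aligns the whole tower with ONE fine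
gauge (charts for `(Ū^i U, Ū^i(U'^g))` at every height, level-`i` gauges `transfUp g i`).  THIS FILE is the two-line dictionary the
induction needs:

* `norm_pertVar_eq_dist1` — `‖pertVar V W b‖ = dist1 (W b · (V b)⁻¹)` (the `SU(N)` model's `dist1 = ‖· − 1‖`);
* ★ `dist1_gaugeAct_mul_inv_le_of_gaugeAct` (any gauge group) — THE GAUGE-DRIFT TRANSFER: for two gauges `h, k` of the same torus,
  `dist1 ((W^h) b · (V b)⁻¹) ≤ dist1 ((W^k) b · (V b)⁻¹) + dist1 (h b₋ · (k b₋)⁻¹) + dist1 (h b₊ · (k b₊)⁻¹)` — a chart in the gauge `k` is a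
  chart in the gauge `h` up to the drift of `h` from `k` at the two endpoints; `norm_pertVar_gaugeAct_le_of_gaugeAct` is the `pertVar` reading;
* ★★ `exists_relGauge_norm_pertVar_iter_le_of_windows` — ✓`exists_relGauge_iter_dist1_le_of_windows` in `pertVar` letters WITH the drift slots: under
  hStab's windows for `U, U'` around `a` there is ONE fine gauge `g` such that for every height `i ≤ j+1`, EVERY gauge `h` of `T^{(i)}` and every
  level-`i` bond `c` in the region, `‖pertVar (Ū^i U) ((Ū^i (U'^g))^h) c‖ ≤ 2B_i + dist1 (h c₋) + dist1 (h c₊)` (`B_i` the ALIGN bound) — so a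
  re-gauged induction started from the pair `(U, U'^g)` keeps the per-bond chart as long as its own gauges stay near `1` in sup.

THEOREMS ONLY, def-free; nothing of h⋆, F5∕F6, `BlockLipschitzL`, the stubs of any registered line, the crux `HistoryTailL` or a summit statement
is proved here.
-/

noncomputable section

open scoped BigOperators Matrix.Norms.L2Operator

namespace Summit.QuantumFields.YangMills.Theorems.PoincareLipschitzHierAlignPertVar

open Literature.MathematicalPhysics.QuantumFieldTheory.Balaban1983to89
open Literature.MathematicalPhysics.QuantumFieldTheory.Balaban1983to89.T3ContinuumYM3Torus
open Literature.MathematicalPhysics.QuantumFieldTheory.Balaban1983to89.T3UnitLawDensityEML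
open T4Continuum BlockAveraging ExpMeanLog T3UnitScaleTilt BlockAveragingEMLLinearisedBackground
open Summit.QuantumFields.YangMills.Theorems.PoincareLipschitzHierAlignT3Simult (exists_relGauge_iter_dist1_le_of_windows)

/-! ## §1 The dictionary and the gauge-drift transfer -/

section Dictionary

variable {P : Params} {j : ℕ}

/-- `‖pertVar V W b‖ = dist1 (W b · (V b)⁻¹)` in the `SU(N)` model (`dist1 g = ‖g − 1‖`). [cite: Balaban1985Variational, (15) p.280] -/
theorem norm_pertVar_eq_dist1 {n : Type*} [Fintype n] [DecidableEq n] [Nonempty n] (V W : GaugeField P j (Matrix.specialUnitaryGroup n ℂ))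
    (b : PBond P j) : ‖pertVar V W b‖ = dist1 (W b * (V b)⁻¹) := by
  rw [FederbushMean.dist1_SU_eq]; rfl

/-- ★ **THE GAUGE-DRIFT TRANSFER** (any gauge group): for gauges `h, k` of `T^{(j)}` and configurations `V, W`,
`dist1 ((W^h) b · (V b)⁻¹) ≤ dist1 ((W^k) b · (V b)⁻¹) + dist1 (h b₋ · (k b₋)⁻¹) + dist1 (h b₊ · (k b₊)⁻¹)`:
`(W^h)_b V_b⁻¹ = (h₋k₋⁻¹)·[(W^k)_b V_b⁻¹]·V_b(k₊h₊⁻¹)V_b⁻¹`. [folklore] -/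
theorem dist1_gaugeAct_mul_inv_le_of_gaugeAct {G : Type*} [GaugeGroup G] (V W : GaugeField P j G) (h k : GaugeTransf P j G) (b : PBond P j) :
    dist1 (GaugeField.gaugeAct h W b * (V b)⁻¹) ≤
      dist1 (GaugeField.gaugeAct k W b * (V b)⁻¹) + dist1 (h b.src * (k b.src)⁻¹) + dist1 (h b.tgt * (k b.tgt)⁻¹) := by
  have e : GaugeField.gaugeAct h W b * (V b)⁻¹ =
      (h b.src * (k b.src)⁻¹) * (GaugeField.gaugeAct k W b * (V b)⁻¹) * (V b * (k b.tgt * (h b.tgt)⁻¹) * (V b)⁻¹) := by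
    simp only [GaugeField.gaugeAct]; group
  rw [e]
  have h1 := GaugeGroup.dist1_mul_le ((h b.src * (k b.src)⁻¹) * (GaugeField.gaugeAct k W b * (V b)⁻¹)) (V b * (k b.tgt * (h b.tgt)⁻¹) * (V b)⁻¹)
  have h2 := GaugeGroup.dist1_mul_le (h b.src * (k b.src)⁻¹) (GaugeField.gaugeAct k W b * (V b)⁻¹)
  have h3 : dist1 (V b * (k b.tgt * (h b.tgt)⁻¹) * (V b)⁻¹) = dist1 (h b.tgt * (k b.tgt)⁻¹) := by
    rw [GaugeGroup.dist1_conj, ← GaugeGroup.dist1_inv, mul_inv_rev, inv_inv]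
  linarith

/-- The same with `k = 1`-drift read as `dist1 (h ·)` when `k` is the identity gauge: `dist1 ((W^h) b · (V b)⁻¹) ≤ dist1 (W b · (V b)⁻¹) + dist1 (h b₋) + dist1 (h b₊)`. [folklore] -/
theorem dist1_gaugeAct_mul_inv_le {G : Type*} [GaugeGroup G] (V W : GaugeField P j G) (h : GaugeTransf P j G) (b : PBond P j) :
    dist1 (GaugeField.gaugeAct h W b * (V b)⁻¹) ≤ dist1 (W b * (V b)⁻¹) + dist1 (h b.src) + dist1 (h b.tgt) := by
  have h1 := dist1_gaugeAct_mul_inv_le_of_gaugeAct V W h (fun _ => 1) b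
  have e : GaugeField.gaugeAct (fun _ => (1 : G)) W b = W b := by simp [GaugeField.gaugeAct]
  rw [e] at h1
  simpa using h1

/-- The `pertVar` reading of the transfer (`SU(N)`): `‖pertVar V (W^h) b‖ ≤ ‖pertVar V (W^k) b‖ + dist1 (h b₋ · (k b₋)⁻¹) + dist1 (h b₊ · (k b₊)⁻¹)`.
[cite: Balaban1985Variational, (15) p.280] -/
theorem norm_pertVar_gaugeAct_le_of_gaugeAct {n : Type*} [Fintype n] [DecidableEq n] [Nonempty n]
    (V W : GaugeField P j (Matrix.specialUnitaryGroup n ℂ)) (h k : GaugeTransf P j (Matrix.specialUnitaryGroup n ℂ)) (b : PBond P j) :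
    ‖pertVar V (GaugeField.gaugeAct h W) b‖ ≤
      ‖pertVar V (GaugeField.gaugeAct k W) b‖ + dist1 (h b.src * (k b.src)⁻¹) + dist1 (h b.tgt * (k b.tgt)⁻¹) := by
  rw [norm_pertVar_eq_dist1, norm_pertVar_eq_dist1]
  exact dist1_gaugeAct_mul_inv_le_of_gaugeAct V W h k b

end Dictionary

/-! ## §2 The simultaneous chart in `pertVar` letters, with the drift slots -/

section Windows

variable {F : T3Family} {K j : ℕ} {γ b₀ p₀ : ℝ}

/-- ★★ **THE SIMULTANEOUS CHART IN THE RE-GAUGED TOWER'S CURRENCY.**  Under hStab's hierarchical windows around `a` for `U` and `U'`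
(`j + 3 ≤ K`, thresholds `≤ 1∕(75(L+1)²)` at the heights `≤ j`) there is ONE gauge `g` of the finest torus such that for every height `i ≤ j + 1`,
EVERY gauge `h` of `T^{(i)}` and every level-`i` bond `c` with scaled corner within `8L^{j+1} + 3(L^i − 1)` of `a₋·L^{j+1}`:
`‖pertVar (Ū^i U) ((Ū^i (U'^g))^h) c‖ ≤ 2·(50L²·Σ_{i≤i'<j+1} θBal(K−i') + 6644L²·θBal(K−j)) + dist1 (h c₋) + dist1 (h c₊)` — the re-gauged
induction started from `(U, U'^g)` keeps the a-priori per-bond chart at every height as long as its own gauges stay near `1`.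
[cite: Balaban1985Averaging, (64)-(68) p.29; Balaban1985Variational, (15) p.280] -/
theorem exists_relGauge_norm_pertVar_iter_le_of_windows (hjK : j + 3 ≤ K) (hγ : 0 < γ) (hγ1 : γ ≤ 1) (hb : 0 < b₀)
    (hθσ : ∀ i, i ≤ j → θBal F.L γ b₀ p₀ (K - i) ≤ 1 / (75 * ((F.L : ℝ) + 1) ^ 2))
    (a : Plaq (F.P K) (j + 1)) (U U' : GaugeField (F.P K) 0 (Matrix.specialUnitaryGroup (Fin 2) ℂ))
    (hU : (∀ (i : ℕ) (q : Plaq (F.P K) i), i < j + 1 → Site.tdist (fun k => ((((q.src k).val * F.L ^ i : ℕ)) : ZMod ((F.P K).sitesPerDir 0))) (fun k => ((((a.src k).val * F.L ^ (j + 1) : ℕ)) : ZMod ((F.P K).sitesPerDir 0))) + 64 * F.L ^ i ≤ 64 * F.L ^ (j + 1) → GaugeGroup.dist1 (GaugeField.plaqHol (Averaging.iter (fun i' => BlockAveraging.blockAvg (P := F.P K) (j := i') T3UnitLawDensityEML.ℰp) i U) q) < T3UnitScaleTilt.θBal F.L γ b₀ p₀ (K - i)))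
    (hU' : (∀ (i : ℕ) (q : Plaq (F.P K) i), i < j + 1 → Site.tdist (fun k => ((((q.src k).val * F.L ^ i : ℕ)) : ZMod ((F.P K).sitesPerDir 0))) (fun k => ((((a.src k).val * F.L ^ (j + 1) : ℕ)) : ZMod ((F.P K).sitesPerDir 0))) + 64 * F.L ^ i ≤ 64 * F.L ^ (j + 1) → GaugeGroup.dist1 (GaugeField.plaqHol (Averaging.iter (fun i' => BlockAveraging.blockAvg (P := F.P K) (j := i') T3UnitLawDensityEML.ℰp) i U') q) < T3UnitScaleTilt.θBal F.L γ b₀ p₀ (K - i))) :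
    ∃ g : GaugeTransf (F.P K) 0 (Matrix.specialUnitaryGroup (Fin 2) ℂ), ∀ (i : ℕ), i ≤ j + 1 →
      ∀ (h : GaugeTransf (F.P K) i (Matrix.specialUnitaryGroup (Fin 2) ℂ)) (c : PBond (F.P K) i),
      Site.tdist (fun k => ((((c.src k).val * F.L ^ i : ℕ)) : ZMod ((F.P K).sitesPerDir 0)))
          (fun k => ((((a.src k).val * F.L ^ (j + 1) : ℕ)) : ZMod ((F.P K).sitesPerDir 0))) ≤ 8 * F.L ^ (j + 1) + 3 * (F.L ^ i - 1) →
      ‖pertVar (Averaging.iter (fun i' => BlockAveraging.blockAvg (P := F.P K) (j := i') T3UnitLawDensityEML.ℰp) i U)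
          (GaugeField.gaugeAct h
            (Averaging.iter (fun i' => BlockAveraging.blockAvg (P := F.P K) (j := i') T3UnitLawDensityEML.ℰp) i (GaugeField.gaugeAct g U'))) c‖ ≤
        2 * (50 * (F.L : ℝ) ^ 2 * (∑ i' ∈ Finset.Ico i (j + 1), θBal F.L γ b₀ p₀ (K - i')) + 6644 * (F.L : ℝ) ^ 2 * θBal F.L γ b₀ p₀ (K - j)) +
          dist1 (h c.src) + dist1 (h c.tgt) := by
  obtain ⟨g, hg⟩ := exists_relGauge_iter_dist1_le_of_windows hjK hγ hγ1 hb hθσ a U U' hU hU'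
  refine ⟨g, fun i hi h c hc => ?_⟩
  have h1 := hg i hi c hc
  rw [norm_pertVar_eq_dist1]
  have h2 := dist1_gaugeAct_mul_inv_le
    (Averaging.iter (fun i' => BlockAveraging.blockAvg (P := F.P K) (j := i') T3UnitLawDensityEML.ℰp) i U)
    (Averaging.iter (fun i' => BlockAveraging.blockAvg (P := F.P K) (j := i') T3UnitLawDensityEML.ℰp) i (GaugeField.gaugeAct g U')) h c
  linarith

end Windows

/-! ## §3 (v1.1) The sharper transfer: a further gauge change costs exactly ITS COVARIANT DERIVATIVE w.r.t. the background

F6-ROW (w2 g11 02:05:54Z) reads the chart at the box-ℓ²-ORBIT-MINIMISING gauge `h = φ·t` rather than at the hierarchical gauge `t`; the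
price is not the size of `φ` but the size of `(V^φ)_b V_b⁻¹ − 1` (the covariant derivative of `φ` along `b` in the background `V`) — small
as soon as `φ` is `V`-harmonic-like, which is what the minimiser's equation and the covariant mean-value theory deliver. -/

section Sharper

variable {P : Params} {j : ℕ}

/-- ★ **GAUGE CHANGE COSTS ITS COVARIANT DERIVATIVE** (any gauge group): for gauges `φ, t` and configurations `V, W`,
`dist1 (((W^t)^φ) b · (V b)⁻¹) ≤ dist1 ((W^t) b · (V b)⁻¹) + dist1 ((V^φ) b · (V b)⁻¹)`:
`((W^t)^φ)_b V_b⁻¹ = [φ₋·((W^t)_b V_b⁻¹)·φ₋⁻¹]·[(V^φ)_b V_b⁻¹]`. [folklore] -/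
theorem dist1_gaugeAct_gaugeAct_mul_inv_le {G : Type*} [GaugeGroup G] (V W : GaugeField P j G) (φ t : GaugeTransf P j G) (b : PBond P j) :
    dist1 (GaugeField.gaugeAct φ (GaugeField.gaugeAct t W) b * (V b)⁻¹) ≤
      dist1 (GaugeField.gaugeAct t W b * (V b)⁻¹) + dist1 (GaugeField.gaugeAct φ V b * (V b)⁻¹) := by
  have e : GaugeField.gaugeAct φ (GaugeField.gaugeAct t W) b * (V b)⁻¹ =
      (φ b.src * (GaugeField.gaugeAct t W b * (V b)⁻¹) * (φ b.src)⁻¹) * (GaugeField.gaugeAct φ V b * (V b)⁻¹) := by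
    simp only [GaugeField.gaugeAct]; group
  rw [e]
  have h1 := GaugeGroup.dist1_mul_le (φ b.src * (GaugeField.gaugeAct t W b * (V b)⁻¹) * (φ b.src)⁻¹) (GaugeField.gaugeAct φ V b * (V b)⁻¹)
  rw [GaugeGroup.dist1_conj] at h1
  exact h1

/-- The `pertVar` reading (`SU(N)`): `‖pertVar V ((W^t)^φ) b‖ ≤ ‖pertVar V (W^t) b‖ + ‖pertVar V (V^φ) b‖`. [cite: Balaban1985Variational, (15) p.280] -/
theorem norm_pertVar_gaugeAct_gaugeAct_le {n : Type*} [Fintype n] [DecidableEq n] [Nonempty n]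
    (V W : GaugeField P j (Matrix.specialUnitaryGroup n ℂ)) (φ t : GaugeTransf P j (Matrix.specialUnitaryGroup n ℂ)) (b : PBond P j) :
    ‖pertVar V (GaugeField.gaugeAct φ (GaugeField.gaugeAct t W)) b‖ ≤ ‖pertVar V (GaugeField.gaugeAct t W) b‖ + ‖pertVar V (GaugeField.gaugeAct φ V) b‖ := by
  rw [norm_pertVar_eq_dist1, norm_pertVar_eq_dist1, norm_pertVar_eq_dist1]
  exact dist1_gaugeAct_gaugeAct_mul_inv_le V W φ t b

end Sharper

section WindowsSharper

variable {F : T3Family} {K j : ℕ} {γ b₀ p₀ : ℝ}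

/-- ★★ **THE SIMULTANEOUS CHART, STABLE UNDER `Ū^iU`-SMALL GAUGE CHANGES.**  Under hStab's hierarchical windows around `a` for `U, U'` there is ONE
fine gauge `g` such that at every height `i ≤ j + 1`, for EVERY further gauge `φ` of `T^{(i)}` and every level-`i` bond `c` in the region:
`‖pertVar (Ū^iU) ((Ū^i(U'^g))^φ) c‖ ≤ 2B_i + ‖pertVar (Ū^iU) ((Ū^iU)^φ) c‖` — the a-priori chart at the orbit minimiser `φ` of F6-ROW costs only the
covariant derivative of `φ` in the background `Ū^iU`. [cite: Balaban1985Averaging, (64)-(68) p.29; Balaban1985Variational, (15) p.280] -/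
theorem exists_relGauge_norm_pertVar_iter_gaugeAct_le_of_windows (hjK : j + 3 ≤ K) (hγ : 0 < γ) (hγ1 : γ ≤ 1) (hb : 0 < b₀)
    (hθσ : ∀ i, i ≤ j → θBal F.L γ b₀ p₀ (K - i) ≤ 1 / (75 * ((F.L : ℝ) + 1) ^ 2))
    (a : Plaq (F.P K) (j + 1)) (U U' : GaugeField (F.P K) 0 (Matrix.specialUnitaryGroup (Fin 2) ℂ))
    (hU : (∀ (i : ℕ) (q : Plaq (F.P K) i), i < j + 1 → Site.tdist (fun k => ((((q.src k).val * F.L ^ i : ℕ)) : ZMod ((F.P K).sitesPerDir 0))) (fun k => ((((a.src k).val * F.L ^ (j + 1) : ℕ)) : ZMod ((F.P K).sitesPerDir 0))) + 64 * F.L ^ i ≤ 64 * F.L ^ (j + 1) → GaugeGroup.dist1 (GaugeField.plaqHol (Averaging.iter (fun i' => BlockAveraging.blockAvg (P := F.P K) (j := i') T3UnitLawDensityEML.ℰp) i U) q) < T3UnitScaleTilt.θBal F.L γ b₀ p₀ (K - i)))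
    (hU' : (∀ (i : ℕ) (q : Plaq (F.P K) i), i < j + 1 → Site.tdist (fun k => ((((q.src k).val * F.L ^ i : ℕ)) : ZMod ((F.P K).sitesPerDir 0))) (fun k => ((((a.src k).val * F.L ^ (j + 1) : ℕ)) : ZMod ((F.P K).sitesPerDir 0))) + 64 * F.L ^ i ≤ 64 * F.L ^ (j + 1) → GaugeGroup.dist1 (GaugeField.plaqHol (Averaging.iter (fun i' => BlockAveraging.blockAvg (P := F.P K) (j := i') T3UnitLawDensityEML.ℰp) i U') q) < T3UnitScaleTilt.θBal F.L γ b₀ p₀ (K - i))) :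
    ∃ g : GaugeTransf (F.P K) 0 (Matrix.specialUnitaryGroup (Fin 2) ℂ), ∀ (i : ℕ), i ≤ j + 1 →
      ∀ (φ : GaugeTransf (F.P K) i (Matrix.specialUnitaryGroup (Fin 2) ℂ)) (c : PBond (F.P K) i),
      Site.tdist (fun k => ((((c.src k).val * F.L ^ i : ℕ)) : ZMod ((F.P K).sitesPerDir 0)))
          (fun k => ((((a.src k).val * F.L ^ (j + 1) : ℕ)) : ZMod ((F.P K).sitesPerDir 0))) ≤ 8 * F.L ^ (j + 1) + 3 * (F.L ^ i - 1) →
      ‖pertVar (Averaging.iter (fun i' => BlockAveraging.blockAvg (P := F.P K) (j := i') T3UnitLawDensityEML.ℰp) i U)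
          (GaugeField.gaugeAct φ
            (Averaging.iter (fun i' => BlockAveraging.blockAvg (P := F.P K) (j := i') T3UnitLawDensityEML.ℰp) i (GaugeField.gaugeAct g U'))) c‖ ≤
        2 * (50 * (F.L : ℝ) ^ 2 * (∑ i' ∈ Finset.Ico i (j + 1), θBal F.L γ b₀ p₀ (K - i')) + 6644 * (F.L : ℝ) ^ 2 * θBal F.L γ b₀ p₀ (K - j)) +
          ‖pertVar (Averaging.iter (fun i' => BlockAveraging.blockAvg (P := F.P K) (j := i') T3UnitLawDensityEML.ℰp) i U)
            (GaugeField.gaugeAct φ (Averaging.iter (fun i' => BlockAveraging.blockAvg (P := F.P K) (j := i') T3UnitLawDensityEML.ℰp) i U)) c‖ := by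
  obtain ⟨g, hg⟩ := exists_relGauge_iter_dist1_le_of_windows hjK hγ hγ1 hb hθσ a U U' hU hU'
  refine ⟨g, fun i hi φ c hc => ?_⟩
  have h1 := hg i hi c hc
  have h2 := dist1_gaugeAct_gaugeAct_mul_inv_le
    (Averaging.iter (fun i' => BlockAveraging.blockAvg (P := F.P K) (j := i') T3UnitLawDensityEML.ℰp) i U)
    (Averaging.iter (fun i' => BlockAveraging.blockAvg (P := F.P K) (j := i') T3UnitLawDensityEML.ℰp) i (GaugeField.gaugeAct g U'))
    φ (fun _ => 1) c
  have e1 : GaugeField.gaugeAct (fun _ => (1 : Matrix.specialUnitaryGroup (Fin 2) ℂ))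
      (Averaging.iter (fun i' => BlockAveraging.blockAvg (P := F.P K) (j := i') T3UnitLawDensityEML.ℰp) i (GaugeField.gaugeAct g U')) =
      Averaging.iter (fun i' => BlockAveraging.blockAvg (P := F.P K) (j := i') T3UnitLawDensityEML.ℰp) i (GaugeField.gaugeAct g U') := by
    funext b; simp [GaugeField.gaugeAct]
  rw [e1] at h2
  rw [norm_pertVar_eq_dist1, norm_pertVar_eq_dist1]
  linarith

end WindowsSharper

end Summit.QuantumFields.YangMills.Theorems.PoincareLipschitzHierAlignPertVar

end
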